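import Literature.Analysis.FunctionSpaces.SobolevBallScaling
import Literature.Analysis.FunctionSpaces.MeyersSerrinProofs
import Summits.QuantumFields.YangMills.Theorems.PoincareLipschitzLatticeToContinuumSobolevLetters
import Mathlib.Analysis.Calculus.BumpFunction.FiniteDimension
import Mathlib.Analysis.Calculus.LocalExtr.Basic
import Mathlib.Analysis.InnerProductSpace.PiL2
import HarnessLib

/-!
# Crux `BlockLipschitzL` (stmt-QuantumFields-23533) ∕ `HistoryTailL` (stmt-QuantumFields-19936), LINE 25 «CompactnessTransfer»,
# stub S1″ — the (TM) re-cut, file TM-B1 «DILATION LETTERS»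

Cell `ym3-torus` (YM ladder rung R3 = continuum SU(2) Yang–Mills on T³ — a RUNG, NOT Clay: not d = 4, not infinite volume,
not a mass gap); WIDTH helper seat `ym3-torus-px3` g9 (LEAD ★w1-19936 g10 «GO (TM)» 14:49:45Z); `--supports
stmt-QuantumFields-23533`; THEOREMS ONLY (0 `def`, 0 `sorry`, default heartbeats); imports lit ✓`SobolevBallScaling`
(`HasWeakFDerivOn.comp_affine`, `setIntegral_preimage_comp_affine`, `MemLp.comp_affine`), lit ✓`MeyersSerrinProofs`
(`hasWeakFDerivOn_congr_ae`), ✓`PoincareLipschitzLatticeToContinuumSobolevLetters` (locality `weakFDeriv_ae_eq_of_eqOn`),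
Mathlib (`ContDiffBump`, `IsLocalMax.fderiv_eq_zero`).

WHAT THIS FILE DOES (generic Sobolev letters for the blow-up argument of the (TM) re-cut; `E` a finite-dimensional real
inner-product space with its Borel volume, `F` a complete real normed space unless stated):
* §1 ★★ `hasWeakFDerivOn_extend_indicator` — **EXTENSION OF A WEAK GRADIENT OFF A BALL**: if `D` has weak gradient `g` on an
  open `O ⊇ B̄_{r₂}(c)` and `D = 0` wherever `dist(·, c) ≥ r₁` (`0 < r₁ < r₂`), then for every `S` with
  `B̄_{r₁}(c) ⊆ S ⊆ B_{r₂}(c)` and EVERY open `Ω`, `S.indicator g` is a weak gradient of `D` on `Ω` (one `ContDiffBump`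
  between `r₁` and `r₂`; the gradient of the bump vanishes on `B̄_{r₁}` by `IsLocalMax.fderiv_eq_zero`; locality of weak
  gradients kills `g` a.e. on the open shell where `D = 0`).  This is the competitor-transport glue of TM-B2.
* §2 ★ `dens_smul`, ★ `preimage_smul_ball`, ★ `smul_mem_unitCube`, ★★ `setIntegral_dens_dilate_ball` /
  ★★ `setIntegral_dens_dilate_inv_ball` — the Dirichlet density `Σᵢ‖G eᵢ‖²` of the dilated gradient `λ•G(λ•x)` and the
  change of variables `∫_{B_r(y)} Σᵢ‖(λ•G(λx)) eᵢ‖² dx = λ⁻¹·∫_{B_{λr}(λy)} Σᵢ‖G eᵢ‖²` on `E³ = EuclideanSpace ℝ (Fin 3)`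
  (and the inverse form with `λ⁻¹`), from ✓`setIntegral_preimage_comp_affine` (`finrank = 3`).
HONEST SCOPE.  Letters only; nothing of (TM), (ZD), (C), S1″, K1, `MeanDeviationL`, `BlockLipschitzL`, `HistoryTailL` is
proved here.  YM₃ on T³ is rung R3, not Clay; YM gap NOT proved; no summit statement is proved here.

References: L. C. Evans, Partial Differential Equations, 2nd ed. (2010) [Evans2010] (§5.2.1: weak derivatives, locality,
cut-offs); L. Simon, Theorems on Regularity and Singularity of Energy Minimizing Maps (1996) [Simon1996] (§2.1, §3.1:
rescaled maps `u_{y,λ}(x) = u(y + λx)`).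
-/

set_option autoImplicit false

noncomputable section

open scoped BigOperators Topology ContDiff
open MeasureTheory Set Filter Metric Function TopologicalSpace

namespace Summit.QuantumFields.YangMills.Theorems.PoincareLipschitzMinimiserDilationLetters

open Literature.Analysis.FunctionSpaces (HasWeakFDerivOn IsTestFunctionOn affinePreimage coe_affinePreimage
  setIntegral_preimage_comp_affine)
open Literature.Analysis.FunctionSpaces.SobolevApprox (hasWeakFDerivOn_zero)
open Literature.Analysis.FunctionSpaces.MeyersSerrin (hasWeakFDerivOn_congr_ae)
open Summit.QuantumFields.YangMills.Theorems.PoincareLipschitzLatticeToContinuumSobolevLetters (weakFDeriv_ae_eq_of_eqOn)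

/-! ## §1 Extension of a weak gradient off a ball -/

section Extend

variable {E : Type*} [NormedAddCommGroup E] [InnerProductSpace ℝ E] [FiniteDimensional ℝ E]
  [MeasurableSpace E] [BorelSpace E]
variable {F : Type*} [NormedAddCommGroup F] [NormedSpace ℝ F] [CompleteSpace F]

omit [MeasurableSpace E] [BorelSpace E] in
/-- The gradient of a bump function vanishes on the closed inner ball (there it attains its maximum `1`). [folklore] -/
theorem fderiv_bump_eq_zero_of_dist_le {c : E} (χ : ContDiffBump c) {x : E} (hx : dist x c ≤ χ.rIn) :
    fderiv ℝ (χ : E → ℝ) x = 0 := by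
  have hmax : IsLocalMax (χ : E → ℝ) x :=
    Filter.Eventually.of_forall fun y => (χ.le_one (x := y)).trans_eq (χ.one_of_mem_closedBall (mem_closedBall.2 hx)).symm
  exact hmax.fderiv_eq_zero

/-- ★★ **EXTENSION OF A WEAK GRADIENT OFF A BALL.**  Let `D` have the weak gradient `g` on the open set `O`, let
`0 < r₁ < r₂` with `B̄_{r₂}(c) ⊆ O`, and suppose `D x = 0` whenever `r₁ ≤ dist(x, c)`.  Then for every set `S` with
`B̄_{r₁}(c) ⊆ S ⊆ B_{r₂}(c)` and every open `Ω`, the field `S.indicator g` is a weak gradient of `D` on `Ω`.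
Proof: with a bump `χ` (`= 1` on `B̄_{r₁}`, supported in `B_{(r₁+r₂)∕2}`), `∂_v φ · D = ∂_v(χφ) · D` pointwise (the
`φ·∂_vχ·D` term vanishes everywhere), `χφ` is a test function on `O`, so `∫ ∂_vφ·D = -∫ (χφ)·g v = -∫ φ·(χ•g) v`; and
`χ•g = S.indicator g` a.e. since `g = 0` a.e. on the open shell `B_{r₂} ∖ B̄_{r₁}` where `D = 0` (locality). [cite: Evans2010, §5.2.1] -/
theorem hasWeakFDerivOn_extend_indicator {O : Opens E} {D : E → F} {g : E → E →L[ℝ] F}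
    (hD : HasWeakFDerivOn O volume D g) {c : E} {r₁ r₂ : ℝ} (hr₁ : 0 < r₁) (hr₁₂ : r₁ < r₂)
    (hO : closedBall c r₂ ⊆ (O : Set E)) (hzero : ∀ x : E, r₁ ≤ dist x c → D x = 0)
    {S : Set E} (hS₁ : closedBall c r₁ ⊆ S) (hS₂ : S ⊆ ball c r₂) (Ω : Opens E) :
    HasWeakFDerivOn Ω volume D (S.indicator g) := by
  -- the bump
  let χ : ContDiffBump c := ⟨r₁, (r₁ + r₂) / 2, hr₁, by linarith⟩
  have hχIn : χ.rIn = r₁ := rfl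
  have hχOut : χ.rOut = (r₁ + r₂) / 2 := rfl
  have hχts : tsupport (χ : E → ℝ) ⊆ (O : Set E) := by
    rw [χ.tsupport_eq, hχOut]; exact (closedBall_subset_closedBall (by linarith)).trans hO
  have hχc : Continuous (χ : E → ℝ) := χ.continuous
  -- `D` is globally integrable (integrable on `B̄_{r₂} ⊆ O`, zero off `B̄_{r₁}`)
  have hDint : Integrable D volume := by
    have h1 : IntegrableOn D (closedBall c r₂) volume :=
      hD.locallyIntegrableOn.integrableOn_compact_subset hO (isCompact_closedBall c r₂)
    refine h1.integrable_of_forall_notMem_eq_zero fun x hx => hzero x ?_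
    have : ¬ dist x c ≤ r₂ := fun h => hx (mem_closedBall.2 h)
    linarith [not_le.1 this]
  -- `χ • g` is globally integrable
  have hχgint : Integrable (fun x => (χ x) • g x) volume := by
    have h1 : IntegrableOn g (tsupport (χ : E → ℝ)) volume :=
      hD.locallyIntegrableOn_deriv.integrableOn_compact_subset hχts χ.hasCompactSupport
    have h2 : IntegrableOn (fun x => (χ x) • g x) (tsupport (χ : E → ℝ)) volume :=
      h1.continuousOn_smul hχc.continuousOn χ.hasCompactSupport
    refine IntegrableOn.integrable_of_forall_notMem_eq_zero (ε' := E →L[ℝ] F) h2 fun x hx => ?_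
    simp only [image_eq_zero_of_notMem_tsupport hx, zero_smul]
  -- Step 1: `χ • g` is a weak gradient of `D` on `Ω`
  have step1 : HasWeakFDerivOn Ω volume D (fun x => (χ x) • g x) := by
    refine ⟨hDint.locallyIntegrable.locallyIntegrableOn _, hχgint.locallyIntegrable.locallyIntegrableOn _, fun φ v hφ => ?_⟩
    -- the test function `ψ = χ φ` on `O`
    have hψc : ContDiff ℝ ∞ (fun x => χ x * φ x) := χ.contDiff.mul hφ.contDiff
    have hψO : IsTestFunctionOn O (fun x => χ x * φ x) :=
      ⟨hψc, hφ.hasCompactSupport.mul_left, (tsupport_mul_subset_left).trans hχts⟩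
    have hψΩ : tsupport (fun x => χ x * φ x) ⊆ (Ω : Set E) := (tsupport_mul_subset_right).trans hφ.tsupport_subset
    have hψOs : tsupport (fun x => χ x * φ x) ⊆ (O : Set E) := hψO.tsupport_subset
    -- product rule, and the two pointwise identities
    have hprod : ∀ x, fderiv ℝ (fun x => χ x * φ x) x v = χ x * fderiv ℝ φ x v + φ x * fderiv ℝ (χ : E → ℝ) x v := by
      intro x
      have h1 : DifferentiableAt ℝ (χ : E → ℝ) x := (χ.contDiff (n := 1)).differentiable one_ne_zero x
      have h2 : DifferentiableAt ℝ φ x := hφ.contDiff.differentiable (by simp) x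
      rw [fderiv_fun_mul h1 h2]
      simp only [FunLike.coe_add, Pi.add_apply, FunLike.coe_smul, Pi.smul_apply, smul_eq_mul]
    have hpt1 : ∀ x, (fderiv ℝ φ x v) • D x = (fderiv ℝ (fun x => χ x * φ x) x v) • D x := by
      intro x
      by_cases hx : r₁ ≤ dist x c
      · rw [hzero x hx, smul_zero, smul_zero]
      · have hx' : dist x c ≤ r₁ := (not_le.1 hx).le
        have hχ1 : χ x = 1 := χ.one_of_mem_closedBall (mem_closedBall.2 (hχIn ▸ hx'))
        have hχ0 : fderiv ℝ (χ : E → ℝ) x = 0 := fderiv_bump_eq_zero_of_dist_le χ (hχIn ▸ hx')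
        rw [hprod x, hχ1, hχ0, one_mul]
        simp
    have hpt2 : ∀ x, (χ x * φ x) • g x v = φ x • ((χ x) • g x) v := by
      intro x; rw [FunLike.coe_smul, Pi.smul_apply, smul_smul, mul_comm]
    -- vanishing off the support of `ψ`
    have hz1 : ∀ x, x ∉ tsupport (fun x => χ x * φ x) → (fderiv ℝ (fun x => χ x * φ x) x v) • D x = 0 :=
      fun x hx => by simp [fderiv_of_notMem_tsupport ℝ hx]
    have hz2 : ∀ x, x ∉ tsupport (fun x => χ x * φ x) → (χ x * φ x) • g x v = 0 :=
      fun x hx => by simp [image_eq_zero_of_notMem_tsupport hx]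
    have key := hD.integral_fderiv_smul_eq _ v hψO
    rw [setIntegral_eq_integral_of_forall_compl_eq_zero fun x hx => hz1 x fun h => hx (hψOs h),
      setIntegral_eq_integral_of_forall_compl_eq_zero fun x hx => hz2 x fun h => hx (hψOs h)] at key
    calc ∫ x in (Ω : Set E), (fderiv ℝ φ x v) • D x
        = ∫ x in (Ω : Set E), (fderiv ℝ (fun x => χ x * φ x) x v) • D x := by simp_rw [hpt1]
      _ = ∫ x, (fderiv ℝ (fun x => χ x * φ x) x v) • D x :=
          setIntegral_eq_integral_of_forall_compl_eq_zero fun x hx => hz1 x fun h => hx (hψΩ h)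
      _ = -∫ x, (χ x * φ x) • g x v := key
      _ = -∫ x in (Ω : Set E), (χ x * φ x) • g x v := by
          rw [setIntegral_eq_integral_of_forall_compl_eq_zero fun x hx => hz2 x fun h => hx (hψΩ h)]
      _ = -∫ x in (Ω : Set E), φ x • ((χ x) • g x) v := by simp_rw [hpt2]
  -- Step 2: `χ • g = S.indicator g` a.e. (locality of weak gradients on the open shell)
  have hV : IsOpen (ball c r₂ \ closedBall c r₁) := isOpen_ball.sdiff isClosed_closedBall
  set V : Opens E := ⟨ball c r₂ \ closedBall c r₁, hV⟩ with hV_def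
  have hVO : V ≤ O := fun x hx => hO (ball_subset_closedBall hx.1)
  have hDV : ∀ x ∈ (V : Set E), D x = (0 : E → F) x := fun x hx => by
    have : ¬ dist x c ≤ r₁ := fun h => hx.2 (mem_closedBall.2 h)
    simpa using hzero x (not_le.1 this).le
  have hg0 : g =ᵐ[volume.restrict (V : Set E)] (0 : E → E →L[ℝ] F) :=
    weakFDeriv_ae_eq_of_eqOn (hasWeakFDerivOn_zero (Ω := O) (μ := volume)) hD hVO hDV
  have hae : (fun x => S.indicator g x) =ᵐ[volume.restrict (Ω : Set E)] fun x => (χ x) • g x := by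
    have h1 : ∀ᵐ x ∂(volume : Measure E), x ∈ (V : Set E) → g x = 0 := by
      have := (ae_restrict_iff' hV.measurableSet).1 hg0
      filter_upwards [this] with x hx hxV using hx hxV
    refine ae_restrict_of_ae ?_
    filter_upwards [h1] with x hx
    by_cases hx1 : dist x c ≤ r₁
    · rw [indicator_of_mem (hS₁ (mem_closedBall.2 hx1)), χ.one_of_mem_closedBall (mem_closedBall.2 (hχIn ▸ hx1)), one_smul]
    · by_cases hx2 : dist x c < r₂
      · have hxV : x ∈ (V : Set E) := ⟨mem_ball.2 hx2, fun h => hx1 (mem_closedBall.1 h)⟩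
        rw [hx hxV, smul_zero]
        by_cases hxS : x ∈ S
        · rw [indicator_of_mem hxS, hx hxV]
        · rw [indicator_of_notMem hxS]
      · have hxS : x ∉ S := fun h => hx2 (mem_ball.1 (hS₂ h))
        have hχ0 : χ x = 0 := χ.zero_of_le_dist (by rw [hχOut]; linarith [not_lt.1 hx2])
        rw [indicator_of_notMem hxS, hχ0, zero_smul]
  exact hasWeakFDerivOn_congr_ae step1 (ae_eq_refl _) hae

end Extend

/-! ## §2 Dilations on `E³`: density scaling, ball preimages, change of variables -/

section Dilate

variable {F : Type*} [NormedAddCommGroup F] [NormedSpace ℝ F]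

/-- The Dirichlet density of a rescaled linear map: `Σᵢ ‖(c • A) eᵢ‖² = c²·Σᵢ ‖A eᵢ‖²`. [folklore] -/
theorem dens_smul (c : ℝ) (A : EuclideanSpace ℝ (Fin 3) →L[ℝ] F) :
    ∑ i : Fin 3, ‖(c • A) (EuclideanSpace.single i (1:ℝ))‖ ^ 2 = c ^ 2 * ∑ i : Fin 3, ‖A (EuclideanSpace.single i (1:ℝ))‖ ^ 2 := by
  rw [Finset.mul_sum]
  refine Finset.sum_congr rfl fun i _ => ?_
  rw [FunLike.coe_smul, Pi.smul_apply, norm_smul, mul_pow, Real.norm_eq_abs, sq_abs]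

/-- Preimage of a ball under the dilation `x ↦ λ•x` (`λ > 0`): `(λ•)⁻¹ B_{λr}(λy) = B_r(y)`. [folklore] -/
theorem preimage_smul_ball {t : ℝ} (ht : 0 < t) (y : EuclideanSpace ℝ (Fin 3)) (r : ℝ) :
    (fun x : EuclideanSpace ℝ (Fin 3) => t • x) ⁻¹' ball (t • y) (t * r) = ball y r := by
  ext x
  simp only [mem_preimage, mem_ball, dist_eq_norm, ← smul_sub, norm_smul, Real.norm_eq_abs, abs_of_pos ht]
  exact ⟨fun h => lt_of_mul_lt_mul_left h ht.le, fun h => mul_lt_mul_of_pos_left h ht⟩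

/-- The same preimage with the affine spelling `x ↦ 0 + λ•x` of lit `SobolevBallScaling`. [folklore] -/
theorem preimage_affine_ball {t : ℝ} (ht : 0 < t) (y : EuclideanSpace ℝ (Fin 3)) (r : ℝ) :
    (fun x : EuclideanSpace ℝ (Fin 3) => (0 : EuclideanSpace ℝ (Fin 3)) + t • x) ⁻¹' ball (t • y) (t * r) = ball y r := by
  simp only [zero_add]; exact preimage_smul_ball ht y r

/-- Dilations by `0 < λ ≤ 1` map the open unit cube `Q` into itself. [folklore] -/
theorem smul_mem_unitCube {t : ℝ} (ht : 0 < t) (ht1 : t ≤ 1) {x : EuclideanSpace ℝ (Fin 3)}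
    (hx : ∀ i : Fin 3, |x i| < 1) : ∀ i : Fin 3, |(t • x) i| < 1 := by
  intro i
  rw [PiLp.smul_apply, smul_eq_mul, abs_mul, abs_of_pos ht]
  calc t * |x i| < t * 1 := mul_lt_mul_of_pos_left (hx i) ht
    _ ≤ 1 := by linarith

/-- If `λ⁻¹•x ∈ Q` and `0 < λ ≤ 1` then `x ∈ Q`. [folklore] -/
theorem mem_unitCube_of_inv_smul_mem {t : ℝ} (ht : 0 < t) (ht1 : t ≤ 1) {x : EuclideanSpace ℝ (Fin 3)}
    (hx : ∀ i : Fin 3, |(t⁻¹ • x) i| < 1) : ∀ i : Fin 3, |x i| < 1 := by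
  have h := smul_mem_unitCube ht ht1 hx
  simpa only [smul_smul, mul_inv_cancel₀ ht.ne', one_smul] using h

/-- ★★ **CHANGE OF VARIABLES FOR BALL ENERGIES UNDER DILATION.**  For `λ > 0`, any `G : E³ → (E³ →L F)`, centre `y` and radius
`r`: `∫_{B_r(y)} Σᵢ‖(λ•G(λ•x)) eᵢ‖² dx = λ⁻¹ · ∫_{B_{λr}(λ•y)} Σᵢ‖G eᵢ‖²` (`dx ↦ λ⁻³dx`, density `↦ λ²`). [cite: Simon1996, §2.1 and §3.1 (rescaled maps)] -/
theorem setIntegral_dens_dilate_ball {t : ℝ} (ht : 0 < t) (G : EuclideanSpace ℝ (Fin 3) → (EuclideanSpace ℝ (Fin 3) →L[ℝ] F))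
    (y : EuclideanSpace ℝ (Fin 3)) (r : ℝ) :
    ∫ x in ball y r, ∑ i : Fin 3, ‖(t • G (t • x)) (EuclideanSpace.single i (1:ℝ))‖ ^ 2 =
      t⁻¹ * ∫ x in ball (t • y) (t * r), ∑ i : Fin 3, ‖G x (EuclideanSpace.single i (1:ℝ))‖ ^ 2 := by
  have hcv := setIntegral_preimage_comp_affine (F := ℝ) ht (0 : EuclideanSpace ℝ (Fin 3))
    (fun x => ∑ i : Fin 3, ‖G x (EuclideanSpace.single i (1:ℝ))‖ ^ 2) (ball (t • y) (t * r))
  rw [preimage_affine_ball ht y r] at hcv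
  simp only [zero_add, smul_eq_mul, finrank_euclideanSpace_fin] at hcv
  simp_rw [dens_smul]
  rw [integral_const_mul, hcv, ← mul_assoc]
  congr 1
  rw [show (t ^ 3)⁻¹ = t⁻¹ * (t⁻¹ * t⁻¹) by rw [← mul_inv, ← mul_inv]; ring_nf]
  field_simp

/-- ★★ **THE INVERSE CHANGE OF VARIABLES.**  For `λ > 0`: `∫_{B_{λρ}(λ•y)} Σᵢ‖(λ⁻¹•GW(λ⁻¹•x)) eᵢ‖² dx = λ · ∫_{B_ρ(y)} Σᵢ‖GW eᵢ‖²`. [cite: Simon1996, §2.1 and §3.1 (rescaled maps)] -/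
theorem setIntegral_dens_dilate_inv_ball {t : ℝ} (ht : 0 < t) (GW : EuclideanSpace ℝ (Fin 3) → (EuclideanSpace ℝ (Fin 3) →L[ℝ] F))
    (y : EuclideanSpace ℝ (Fin 3)) (ρ : ℝ) :
    ∫ x in ball (t • y) (t * ρ), ∑ i : Fin 3, ‖(t⁻¹ • GW (t⁻¹ • x)) (EuclideanSpace.single i (1:ℝ))‖ ^ 2 =
      t * ∫ x in ball y ρ, ∑ i : Fin 3, ‖GW x (EuclideanSpace.single i (1:ℝ))‖ ^ 2 := by
  have hti : 0 < t⁻¹ := inv_pos.2 ht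
  have h := setIntegral_dens_dilate_ball (F := F) hti GW (t • y) (t * ρ)
  rw [smul_smul, inv_mul_cancel₀ ht.ne', one_smul, ← mul_assoc, inv_mul_cancel₀ ht.ne', one_mul, inv_inv] at h
  exact h

end Dilate

end Summit.QuantumFields.YangMills.Theorems.PoincareLipschitzMinimiserDilationLetters

end
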